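import Mathlib
import Literature.Analysis.FluidPDE.TypeIAncientMild
import Literature.Analysis.FluidPDE.SelfSimilar
import Summits.NavierStokesRegularity.NavierStokesRegularity.Theses.SymmetryModuliCount
import Summits.NavierStokesRegularity.NavierStokesRegularity.Theorems.ScenarioCensusScrewBlowdownVanishing
import Summits.NavierStokesRegularity.NavierStokesRegularity.Theorems.DssFarFieldSlavingBlowupTypeIDssProfileSimilarityEnstrophyTimeOnlyThreshold
import HarnessLib

/-!
# Census block A2 (amplitude meters), cells A2epG (master) / A2epA / A2epC (DECIDED), A2epB / A2epU (OPEN) — instrument «EPOCH METER» (the scale-invariant amplitude read on TIME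
# EPOCHS), LINE g16-3 «epoch-meter» port, part 1/2: §A the instrument (`amp`, `EpochQuiet`, `EpochQuietAll`, `HasLongQuietEpochs`), §B one-limit Liouville (the sharpened lever), §C
# the master law: long receding quiet epochs are excluded

Re-homed for the scenario census (typer seat ns-census-typer-1 g9; the cells A2epG / A2epA / A2epC are MEMBERS OF RECORD «DECIDED IN KERNEL IN FILES» of block A2 since census
v1.97 (item 65: critic PASS; ref PRE-CHECK ✓; lead label); this port makes them TREE-decided): VERBATIM PORT of ns-idea-2 LINE g16-3 «epoch-meter»,
`pub/ideators/ns-idea-2/lines/epoch-meter/line-epoch-meter.lean` sha16 5c4cdebe765f5398 (510 l., lean check rc 0, 0 sorry), split for the 400-line rule into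
`ScenarioCensusEpochMeter` (§A–§C) → `…EpochMeterRows` (§D–§F + census KEYS).  Lean text VERBATIM in namespace `…Theorems.ScenarioCensus.EpochMeter` (the line's
`…Lines.EpochMeter` re-homed); port edits: `local notation "E3"` → `abbrev E3` (typer lint), `set_option linter.unusedVariables false` dropped (the record: a port must drop it;
unused binders `_`-prefixed where the linter asks, proof text only), the `variable {C} {u}` line repeated at the head of part 2, `@[conjecture]` on the OPEN rows `Row_A2epB` /
`Row_A2epU` (typed only), five one-line docstrings added (gate lint).  Statements untouched.

No census VALUE is moved here (the cells become TREE-decided by name; booking is the lead's); NS regularity is NOT proved; (L′) ⟨10661⟩ is untouched; no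
summit statement is proved by this file.
-/

-- the summit and its single problem share the name `NavierStokesRegularity` (D-0017 nested layout)
set_option linter.dupNamespace false

noncomputable section

open Set Function Filter Metric
open scoped Topology
open Literature.Analysis.FluidPDE
open Summit.NavierStokesRegularity.NavierStokesRegularity.Theorems
open Summit.NavierStokesRegularity.NavierStokesRegularity.Theorems.SimilarityEnstrophy

namespace Summit.NavierStokesRegularity.NavierStokesRegularity.Theorems.ScenarioCensus.EpochMeter

/-- `ℝ³` (the line's `local notation "E3"`, spelled as a reducible abbreviation for the tree). -/
abbrev E3 := EuclideanSpace ℝ (Fin 3)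

variable {C : ℝ} {u : ℝ → E3 → E3}

/-! ## A. The instrument -/

/-- The scale-invariant AMPLITUDE reading of `u` at `(s, x)`: `√(−s)·‖u(s, x)‖`. -/
def amp (u : ℝ → E3 → E3) (s : ℝ) (x : E3) : ℝ := Real.sqrt (-s) * ‖u s x‖

/-- `u` is `ε`-QUIET throughout the epoch `[a, b]` on the parabolic CORES of aperture `K` (`‖x‖ ≤ K√(−s)`). -/
def EpochQuiet (ε K : ℝ) (u : ℝ → E3 → E3) (a b : ℝ) : Prop :=
  ∀ s : ℝ, a ≤ s → s ≤ b → ∀ x : E3, ‖x‖ ≤ K * Real.sqrt (-s) → amp u s x ≤ ε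

/-- `u` is `ε`-QUIET throughout the epoch `[a, b]` on ALL of space. -/
def EpochQuietAll (ε : ℝ) (u : ℝ → E3 → E3) (a b : ℝ) : Prop :=
  ∀ s : ℝ, a ≤ s → s ≤ b → ∀ x : E3, amp u s x ≤ ε

/-- LONG RECEDING QUIET EPOCHS at level `ε`: epochs `[aₖ, bₖ] ⊂ (−∞, 0)` receding into the past (`bₖ → −∞`),
of log-length `log(aₖ/bₖ) → ∞`, the `k`-th one `ε`-quiet on cores of aperture `Kₖ → ∞`. -/
def HasLongQuietEpochs (ε : ℝ) (u : ℝ → E3 → E3) : Prop :=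
  ∃ a b K : ℕ → ℝ, (∀ k, a k < b k ∧ b k < 0) ∧ Tendsto b atTop atBot ∧
    Tendsto (fun k => a k / b k) atTop atTop ∧ Tendsto K atTop atTop ∧ ∀ k, EpochQuiet ε (K k) u (a k) (b k)

/-- The scale-invariant amplitude is non-negative. -/
theorem amp_nonneg (u : ℝ → E3 → E3) (s : ℝ) (x : E3) : 0 ≤ amp u s x :=
  mul_nonneg (Real.sqrt_nonneg _) (norm_nonneg _)

/-- Calibration: on the class the meter reads in `[0, C]`. -/
theorem amp_le (hu : IsTypeIAncientMild C u) {s : ℝ} (hs : s < 0) (x : E3) : amp u s x ≤ C := by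
  have hsr : 0 < Real.sqrt (-s) := Real.sqrt_pos.2 (by linarith)
  have h := hu.norm_le hs x
  rw [le_div_iff₀ hsr] at h
  simpa [amp, mul_comm] using h

/-- All-space quietness is core quietness at every aperture. -/
theorem EpochQuietAll.epochQuiet {ε a b : ℝ} (h : EpochQuietAll ε u a b) (K : ℝ) : EpochQuiet ε K u a b :=
  fun s has hsb x _ => h s has hsb x

/-- Monotonicity of the reading in the level and the aperture. -/
theorem EpochQuiet.mono {ε ε' K K' a b : ℝ} (h : EpochQuiet ε K u a b) (hε : ε ≤ ε') (hK : K' ≤ K) :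
    EpochQuiet ε' K' u a b := by
  intro s has hsb x hx
  have hx' : ‖x‖ ≤ K * Real.sqrt (-s) := hx.trans (mul_le_mul_of_nonneg_right hK (Real.sqrt_nonneg _))
  exact (h s has hsb x hx').trans hε

/-- THE METER READS ZOOMS: the amplitude of the `μ`-zoom at `(t, x)` is the amplitude of `u` at the earlier
time `μ² t` and the point `μ x` (definitional). -/
theorem amp_nsRescale {μ t : ℝ} (hμ : 0 < μ) (_ht : t < 0) (x : E3) :
    amp (nsRescale μ u) t x = amp u (μ ^ 2 * t) (μ • x) := by
  have hsq : Real.sqrt (-(μ ^ 2 * t)) = μ * Real.sqrt (-t) := by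
    rw [show -(μ ^ 2 * t) = μ ^ 2 * (-t) by ring, Real.sqrt_mul (sq_nonneg _), Real.sqrt_sq hμ.le]
  simp only [amp, nsRescale, hsq, norm_smul, Real.norm_eq_abs, abs_of_pos hμ]
  ring

/-! ## B. One-limit Liouville (the sharpened lever) -/

/-- **ONE-LIMIT LIOUVILLE** (PROVED; corollary of the tree's `ScrewBlowdown.substantial_at_large_scales`,
ns-idea-4 v1.9): a Type-I ancient mild field with ONE identically vanishing blow-down limit vanishes.  (Along the
limit's scales the zooms become `ε_C`-small on the unit-time ball `B(0, K_C)`, which a nonzero element forbids at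
all large scales.)  S3 `vanishingBlowdownLiouville_holds` asks this of ALL blow-down limits. -/
theorem eq_zero_of_blowdownLimit_zero (hu : IsTypeIAncientMild C u) {W : ℝ → E3 → E3}
    (hW : ScenarioCensus.ScrewBlowdown.IsBlowdownLimit C u W) (h0 : ∀ t < 0, ∀ x, W t x = 0) :
    ∀ t < 0, ∀ x, u t x = 0 := by
  by_contra hne
  push Not at hne
  obtain ⟨t₀, ht₀, x₀, hx₀⟩ := hne
  obtain ⟨ε, hε, K, hK, hsub⟩ := ScenarioCensus.ScrewBlowdown.substantial_at_large_scales C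
  obtain ⟨μ₁, hμ₁, hloud⟩ := hsub u hu ⟨t₀, ht₀, x₀, hx₀⟩
  obtain ⟨hWc, ν, hνpos, hνlim, hconv⟩ := hW
  have hK' : IsCompact (Metric.closedBall (0 : E3) K) := isCompact_closedBall _ _
  have hunif : TendstoUniformlyOn (fun j => nsRescale (ν j) u (-1)) (W (-1)) atTop
      (Metric.closedBall (0 : E3) K) :=
    (tendstoLocallyUniformlyOn_iff_tendstoUniformlyOn_of_compact hK').1
      ((hconv (-1) (by norm_num)).tendstoLocallyUniformlyOn)
  have hev := (Metric.tendstoUniformlyOn_iff.1 hunif) ε hε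
  have hev2 : ∀ᶠ j in atTop, μ₁ ≤ ν j := hνlim.eventually_ge_atTop μ₁
  obtain ⟨j, hj, hj2⟩ := (hev.and hev2).exists
  obtain ⟨y, hyK, hbig⟩ := hloud (ν j) hj2
  have hyj : y ∈ Metric.closedBall (0 : E3) K := by
    rw [Metric.mem_closedBall, dist_zero_right]; exact hyK
  have h1 := hj y hyj
  rw [h0 (-1) (by norm_num) y, dist_zero_left] at h1
  exact absurd h1 (not_lt.2 hbig.le)

/-- **One QUIET limit suffices** (PROVED): a blow-down limit that is `θ`-quiet everywhere for some `θ < 1` is zero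
by the time-constant gap A2a (it lies in the class), so the element is zero. -/
theorem eq_zero_of_blowdownLimit_quiet (hu : IsTypeIAncientMild C u) {W : ℝ → E3 → E3}
    (hW : ScenarioCensus.ScrewBlowdown.IsBlowdownLimit C u W) {θ : ℝ} (hθ : θ < 1)
    (hq : ∀ t < 0, ∀ x, Real.sqrt (-t) * ‖W t x‖ ≤ θ) : ∀ t < 0, ∀ x, u t x = 0 :=
  eq_zero_of_blowdownLimit_zero hu hW (typeI_ancient_eq_zero_of_timeConstant_lt_one_noDecay hθ hW.1 hq)

/-- **Every blow-down limit of a NONZERO element is near-critically loud** (PROVED): for every `θ < 1` some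
reading `√(−t)‖W(t, x)‖` exceeds `θ`. -/
theorem blowdownLimit_loud (hu : IsTypeIAncientMild C u) (hne : ∃ t < 0, ∃ x, u t x ≠ 0) {W : ℝ → E3 → E3}
    (hW : ScenarioCensus.ScrewBlowdown.IsBlowdownLimit C u W) {θ : ℝ} (hθ : θ < 1) :
    ∃ t < 0, ∃ x, θ < Real.sqrt (-t) * ‖W t x‖ := by
  by_contra h
  push Not at h
  obtain ⟨t, ht, x, hx⟩ := hne
  exact hx (eq_zero_of_blowdownLimit_quiet hu hW hθ h t ht x)

/-- In particular every blow-down limit of a nonzero element is nonzero (contrast: S3's contrapositive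
`exists_nonzero_blowdownLimit` gives ONE nonzero limit). -/
theorem blowdownLimit_ne_zero (hu : IsTypeIAncientMild C u) (hne : ∃ t < 0, ∃ x, u t x ≠ 0)
    {W : ℝ → E3 → E3} (hW : ScenarioCensus.ScrewBlowdown.IsBlowdownLimit C u W) :
    ∃ t < 0, ∃ x, W t x ≠ 0 := by
  obtain ⟨t, ht, x, hx⟩ := blowdownLimit_loud hu hne hW one_half_lt_one
  refine ⟨t, ht, x, fun h0 => ?_⟩
  rw [h0, norm_zero, mul_zero] at hx
  linarith

/-! ## C. The master law: long receding quiet epochs are excluded -/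

/-- Arithmetic of the geometric-mean scale: with `g² = a·b`, `a < b < 0`, the zoom time `g·t` lies in the epoch
`[a, b]` as soon as the log-length dominates: `t² ≤ a/b` and `t⁻² ≤ a/b`. -/
theorem geomMean_time_mem {a b g t : ℝ} (hab : a < b) (hb : b < 0) (ht : t < 0) (hg : 0 < g)
    (hg2 : g ^ 2 = a * b) (h1 : (-t) ^ 2 ≤ a / b) (h2 : ((-t)⁻¹) ^ 2 ≤ a / b) :
    a ≤ g * t ∧ g * t ≤ b := by
  have ha : a < 0 := hab.trans hb
  have ht' : 0 < -t := by linarith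
  constructor
  · -- `a ≤ b t²` hence `(g(−t))² = ab t² ≤ a²`
    have h1' : a ≤ (-t) ^ 2 * b := (le_div_iff_of_neg hb).1 h1
    have hsq : (g * (-t)) ^ 2 ≤ (-a) ^ 2 := by
      have : 0 ≤ a * (a - b * t ^ 2) := by nlinarith
      nlinarith
    have hle : g * (-t) ≤ -a := (pow_le_pow_iff_left₀ (by positivity) (by linarith) two_ne_zero).1 hsq
    linarith
  · -- `a t² ≤ b` hence `b² ≤ ab t² = (g(−t))²`
    have h2' : a ≤ ((-t)⁻¹) ^ 2 * b := (le_div_iff_of_neg hb).1 h2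
    have hinv : ((-t)⁻¹) ^ 2 * t ^ 2 = 1 := by
      rw [inv_pow, neg_sq, inv_mul_cancel₀ (pow_ne_zero 2 ht.ne)]
    have h2'' : a * t ^ 2 ≤ b := by
      have := mul_le_mul_of_nonneg_right h2' (sq_nonneg t)
      calc a * t ^ 2 ≤ (-t)⁻¹ ^ 2 * b * t ^ 2 := this
        _ = ((-t)⁻¹ ^ 2 * t ^ 2) * b := by ring
        _ = b := by rw [hinv, one_mul]
    have hsq : (-b) ^ 2 ≤ (g * (-t)) ^ 2 := by
      have : b * (b - a * t ^ 2) ≤ 0 := by nlinarith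
      nlinarith
    have hle : -b ≤ g * (-t) := (pow_le_pow_iff_left₀ (by linarith) (by positivity) two_ne_zero).1 hsq
    linarith

/-- Every blow-down limit extracted along the geometric-mean scales of long receding quiet epochs is `ε`-quiet
EVERYWHERE. -/
theorem exists_quiet_blowdownLimit (hu : IsTypeIAncientMild C u) {ε : ℝ} (h : HasLongQuietEpochs ε u) :
    ∃ W, ScenarioCensus.ScrewBlowdown.IsBlowdownLimit C u W ∧ ∀ t < 0, ∀ x, Real.sqrt (-t) * ‖W t x‖ ≤ ε := by
  obtain ⟨a, b, K, hab, hb, hr, hK, hq⟩ := h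
  have hprod : ∀ k, 0 < a k * b k := fun k => mul_pos_of_neg_of_neg ((hab k).1.trans (hab k).2) (hab k).2
  -- geometric mean `g k = √(a k · b k)` and the zoom scale `μ k = √(g k)`
  set g : ℕ → ℝ := fun k => Real.sqrt (a k * b k) with hgdef
  have hgpos : ∀ k, 0 < g k := fun k => Real.sqrt_pos.2 (hprod k)
  have hg2 : ∀ k, g k ^ 2 = a k * b k := fun k => Real.sq_sqrt (hprod k).le
  set μ : ℕ → ℝ := fun k => Real.sqrt (g k) with hμdef
  have hμpos : ∀ k, 0 < μ k := fun k => Real.sqrt_pos.2 (hgpos k)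
  have hμsq : ∀ k, μ k ^ 2 = g k := fun k => Real.sq_sqrt (hgpos k).le
  -- the scales tend to infinity because `g k ≥ −b k → ∞`
  have hg_ge : ∀ k, -b k ≤ g k := by
    intro k
    have hsq : (-b k) ^ 2 ≤ a k * b k := by nlinarith [(hab k).1, (hab k).2]
    calc -b k = Real.sqrt ((-b k) ^ 2) := (Real.sqrt_sq (by linarith [(hab k).2])).symm
      _ ≤ Real.sqrt (a k * b k) := Real.sqrt_le_sqrt hsq
  have hglim : Tendsto g atTop atTop := tendsto_atTop_mono hg_ge (tendsto_neg_atBot_atTop.comp hb)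
  have hμlim : Tendsto μ atTop atTop := by
    refine tendsto_atTop_atTop.2 fun B => ?_
    obtain ⟨N, hN⟩ := tendsto_atTop_atTop.1 hglim (B ^ 2)
    refine ⟨N, fun k hk => (le_abs_self B).trans ?_⟩
    rw [← Real.sqrt_sq_eq_abs]
    exact Real.sqrt_le_sqrt (hN k hk)
  -- extraction of a blow-down limit along a subsequence of the zooms
  obtain ⟨φ, hφ, W, hW, -, -, hloc, -⟩ :=
    exists_tendsto_of_isTypeIAncientMild_seq C (w := fun k => nsRescale (μ k) u)
      fun k => isTypeIAncientMild_nsRescale hu (hμpos k)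
  have hBD : ScenarioCensus.ScrewBlowdown.IsBlowdownLimit C u W :=
    ⟨hW, fun j => μ (φ j), fun j => hμpos _, hμlim.comp hφ.tendsto_atTop, fun t ht => hloc t ht⟩
  refine ⟨W, hBD, fun t ht x => ?_⟩
  have ht' : 0 < -t := by linarith
  have hst : 0 < Real.sqrt (-t) := Real.sqrt_pos.2 ht'
  have hL : Tendsto (fun j => nsRescale (μ (φ j)) u t x) atTop (𝓝 (W t x)) :=
    (hloc t ht).tendsto_comp (hW.continuous_slice ht).continuousAt tendsto_const_nhds
  have hφlim : Tendsto φ atTop atTop := hφ.tendsto_atTop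
  have hr' : Tendsto (fun j => a (φ j) / b (φ j)) atTop atTop := hr.comp hφlim
  have hK' : Tendsto (fun j => K (φ j)) atTop atTop := hK.comp hφlim
  have hev1 : ∀ᶠ j in atTop, (-t) ^ 2 ≤ a (φ j) / b (φ j) := hr'.eventually_ge_atTop _
  have hev2 : ∀ᶠ j in atTop, ((-t)⁻¹) ^ 2 ≤ a (φ j) / b (φ j) := hr'.eventually_ge_atTop _
  have hev3 : ∀ᶠ j in atTop, ‖x‖ / Real.sqrt (-t) ≤ K (φ j) := hK'.eventually_ge_atTop _
  have hevb : ∀ᶠ j in atTop, Real.sqrt (-t) * ‖nsRescale (μ (φ j)) u t x‖ ≤ ε := by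
    filter_upwards [hev1, hev2, hev3] with j h1 h2 h3
    have hak : a (φ j) < b (φ j) := (hab (φ j)).1
    have hbk : b (φ j) < 0 := (hab (φ j)).2
    -- the zoom time `μ² t = g t` lies in the quiet epoch
    obtain ⟨hlo, hhi⟩ := geomMean_time_mem hak hbk ht (hgpos (φ j)) (hg2 (φ j)) h1 h2
    rw [← hμsq (φ j)] at hlo hhi
    -- the zoom point `μ x` lies in the core of aperture `K`
    have hxK : ‖μ (φ j) • x‖ ≤ K (φ j) * Real.sqrt (-(μ (φ j) ^ 2 * t)) := by
      have hx1 : ‖x‖ ≤ K (φ j) * Real.sqrt (-t) := (div_le_iff₀ hst).1 h3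
      have hsq : Real.sqrt (-(μ (φ j) ^ 2 * t)) = μ (φ j) * Real.sqrt (-t) := by
        rw [show -(μ (φ j) ^ 2 * t) = μ (φ j) ^ 2 * (-t) by ring, Real.sqrt_mul (sq_nonneg _),
          Real.sqrt_sq (hμpos _).le]
      rw [norm_smul, Real.norm_eq_abs, abs_of_pos (hμpos _), hsq]
      nlinarith [hμpos (φ j)]
    have hread := hq (φ j) (μ (φ j) ^ 2 * t) hlo hhi (μ (φ j) • x) hxK
    have hdict : Real.sqrt (-t) * ‖nsRescale (μ (φ j)) u t x‖ = amp u (μ (φ j) ^ 2 * t) (μ (φ j) • x) :=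
      amp_nsRescale (hμpos _) ht x
    rw [hdict]
    exact hread
  exact le_of_tendsto (hL.norm.const_mul _) hevb

/-- **MASTER LAW** (PROVED): a Type-I ancient mild field admitting, at ONE subcritical level `ε < 1`, receding
quiet epochs of unbounded log-length on cores of unbounded aperture is identically zero. -/
theorem eq_zero_of_longQuietEpochs (hu : IsTypeIAncientMild C u) {ε : ℝ} (hε : ε < 1)
    (h : HasLongQuietEpochs ε u) : ∀ t < 0, ∀ x, u t x = 0 := by
  obtain ⟨W, hW, hq⟩ := exists_quiet_blowdownLimit hu h
  exact eq_zero_of_blowdownLimit_quiet hu hW hε hq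

/-- The «for every log-length and every horizon there is a quiet epoch» form yields a sequence of long receding
quiet epochs (all-space quietness; apertures are then free). -/
theorem hasLongQuietEpochs_of_forall {ε : ℝ}
    (h : ∀ r T : ℝ, T < 0 → ∃ a b : ℝ, a < b ∧ b ≤ T ∧ a ≤ r * b ∧ EpochQuietAll ε u a b) :
    HasLongQuietEpochs ε u := by
  have hch : ∀ k : ℕ, ∃ a b : ℝ, a < b ∧ b ≤ -((k : ℝ) + 1) ∧ a ≤ ((k : ℝ) + 1) * b ∧ EpochQuietAll ε u a b :=
    fun k => h _ _ (by have := (Nat.cast_nonneg k : (0 : ℝ) ≤ k); linarith)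
  choose a b hab hbT hr hq using hch
  have hbneg : ∀ k, b k < 0 := fun k => by
    have := (Nat.cast_nonneg k : (0 : ℝ) ≤ k); linarith [hbT k]
  have hnat : Tendsto (fun k : ℕ => (k : ℝ) + 1) atTop atTop :=
    tendsto_natCast_atTop_atTop.atTop_add tendsto_const_nhds
  refine ⟨a, b, fun k => (k : ℝ) + 1, fun k => ⟨hab k, hbneg k⟩, ?_, ?_, hnat, fun k => (hq k).epochQuiet _⟩
  · refine tendsto_atBot_mono (fun k => hbT k) ?_
    exact tendsto_neg_atTop_atBot.comp hnat
  · exact tendsto_atTop_mono (fun k => (le_div_iff_of_neg (hbneg k)).2 (hr k)) hnat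

/-- **LOG-SYNDETIC LOUDNESS** (PROVED; the N1 datum): for a NONZERO Type-I ancient mild field and every `ε < 1`
there are a ratio `r > 1` and a horizon `T < 0` such that EVERY epoch `[a, b]` with `b ≤ T` and `a ≤ r·b`
(log-length at least `log r`) contains a reading `√(−s)‖u(s, x)‖ > ε`. -/
theorem logSyndetic_loud_of_ne_zero (hu : IsTypeIAncientMild C u) (hne : ∃ t < 0, ∃ x, u t x ≠ 0) {ε : ℝ}
    (hε : ε < 1) :
    ∃ r T : ℝ, 1 < r ∧ T < 0 ∧
      ∀ a b : ℝ, a < b → b ≤ T → a ≤ r * b → ∃ s ∈ Icc a b, ∃ x : E3, ε < amp u s x := by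
  by_contra hcon
  push Not at hcon
  have hall : ∀ r T : ℝ, T < 0 → ∃ a b : ℝ, a < b ∧ b ≤ T ∧ a ≤ r * b ∧ EpochQuietAll ε u a b := by
    intro r T hT
    -- use the ratio `max r 2 > 1`
    obtain ⟨a, b, hab, hbT, hr, hq⟩ := hcon (max r 2) T (by
      have : (2 : ℝ) ≤ max r 2 := le_max_right _ _; linarith) hT
    have hb : b < 0 := by linarith
    refine ⟨a, b, hab, hbT, hr.trans ?_, fun s has hsb x => hq s ⟨has, hsb⟩ x⟩
    exact mul_le_mul_of_nonpos_right (le_max_left _ _) hb.le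
  obtain ⟨t, ht, x, hx⟩ := hne
  exact hx (eq_zero_of_longQuietEpochs hu hε (hasLongQuietEpochs_of_forall hall) t ht x)

end Summit.NavierStokesRegularity.NavierStokesRegularity.Theorems.ScenarioCensus.EpochMeter

end
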